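import Literature.ComputerArithmetic.GraillatJezequel2020.CompensatedEnclosures

/-!
# The compensated Horner scheme under a directed rounding: the `2u|p(x)| + 2γ₂ₙ₊₁(2u)² p̃(x)`
accuracy bound (Graillat–Jézéquel–Picot 2018, §6.3; Graillat–Jézéquel 2020, Proposition 6.2)

HONEST FRAMING (ENGINES group, unit `eng-quad-4`, kernels lane of the `certquad` engine — shared
numerical engines serving client cells; rigour lives in the verifiers; every published number
belongs to a client cell's ledger, not to the engines group): the kernels evaluate polynomials by
the compensated Horner scheme under a DIRECTED rounding to obtain enclosures
(`GraillatJezequel2020/CompensatedEnclosures.lean`, PROPOSITION 6.3: `Einf ≤ p(x) ≤ Esup`). This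
file types and PROVES, in MODEL form exactly as `LangloisLouvet2006/CompHorner.lean` (rounding to
nearest) and `GraillatJezequelPicot2018/CompensatedSumDot.lean`, the published ACCURACY of those
directed runs — how tight the enclosure is. No hardware, vendor, timing or format claims; the
format-level facts of the source (the model `|fl(t) - t| ≤ 2u|t|` of one directed-rounded
operation, exactness of `TwoProdFMA`, PROPOSITION 4.5 on `FastTwoSum`, absence of underflow) are
HYPOTHESES here, to be discharged per format elsewhere.

Sources read at the page: [GraillatJezequelPicot2018] (Appl. Math. Comput. 329 (2018) 339–363;
author version hal-01367769), §6 "Compensated Horner scheme", §6.3 "with directed rounding":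
ALGORITHMS 10 (`Horner`) and 11 (`CompHorner`), eqs. (6.33)–(6.34), LEMMA 6.2, LEMMA 6.3,
THEOREM 6.4; and [GraillatJezequel2020] (IEEE Trans. Comput. 69 (2020) 1774–1783), §6.2
ALGORITHM 14 and PROPOSITION 6.2, which recalls THEOREM 6.4 (as [14]) with the relative form
`|CompHorner(p, x) - p(x)| / |p(x)| ≤ 2u + 2γ₂ₙ₊₁(2u)² cond(p, x)`. The rounding-to-nearest
results the source recalls (THEOREM 6.1 = [9] Graillat–Langlois–Louvet) are
`LangloisLouvet2006/CompHorner.lean`.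

THE MODEL (ordered field `K`; conventions of `LangloisLouvet2006/CompHorner.lean`).
* `p(x) = Σ_{i<n+1} aᵢ xⁱ` (degree `n`), `p̃(x) = Σ_{i<n+1} |aᵢ| |x|ⁱ`,
  `cond(p, x) = p̃(x)/|p(x)|` (`Higham2002.condPoly`).
* `v ≥ 0` bounds ONE rounded operation in the additive form `|fl(t) - t| ≤ v|t|` of
  [GraillatJezequelPicot2018, §2 eq. (2.2)] (first form); `v = 2u` under a directed rounding.
* TRACE of ALGORITHM 11, lines 1, 4, 5 (the error-free transformations; `EFTHorner` of
  [LangloisLouvet2006]), levels `i = n-1, …, 0`: `sₙ = aₙ`;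
  `sᵢ₊₁ x = pᵢ + πᵢ` with `|πᵢ| ≤ v|sᵢ₊₁ x|` (`TwoProdFMA` is EXACT under any rounding, §5.2,
  so `πᵢ` is both the computed and the exact product error); `pᵢ + aᵢ = sᵢ + τᵢ` with
  `|τᵢ| ≤ v|pᵢ + aᵢ|`, `τᵢ` the EXACT addition error ("not necessarily a floating-point
  number", §6.3), and `σᵢ` the COMPUTED `FastTwoSum` correction with `|σᵢ - τᵢ| ≤ v|τᵢ|`
  (PROPOSITION 4.5, `|e - d| ≤ 2u|e|`). Eq. (6.33): `p(x) = s₀ + p_π(x) + p_τ(x)` is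
  `LangloisLouvet2006.eftHorner_add_sum_eq` (with `τ` in the slot named `σ` there).
* TRACE of ALGORITHM 11, lines 2 and 6, `rᵢ = fl(fl(rᵢ₊₁ x) + fl(πᵢ + σᵢ))`: `rₙ = 0`,
  `|qᵢ - rᵢ₊₁ x| ≤ v|rᵢ₊₁ x|`, `|cᵢ - (πᵢ + σᵢ)| ≤ v|πᵢ + σᵢ|`, `|rᵢ - (qᵢ + cᵢ)| ≤ v|qᵢ + cᵢ|`;
  line 8, `res = fl(s₀ + r₀)`: `|res - (s₀ + r₀)| ≤ v|s₀ + r₀|`. As in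
  `CompensatedSumDot.lean`, the model also charges the top-level operations `fl(0 · x)` and
  `fl(0 + c)`, which are exact in floating point; the printed constants absorb this.

Typed and PROVED ([cite: GraillatJezequelPicot2018, §6.3] unless stated):
* ALGORITHM 11 line 6 as a Horner-type accumulation of ANY coefficients `eᵢ`, each itself
  rounded, under the model — `abs_corrAcc_sub_sum_le`:
  `|r₀ - Σ_{i<n} eᵢ xⁱ| ≤ ((1 + v)²ⁿ - 1) Σ_{i<n} |eᵢ| |x|ⁱ`. This is the scheme of LEMMA 6.3
  (`rᵢ ← fl*(rᵢ₊₁·x + (aᵢ + bᵢ))` evaluating `r = p + q` of degree `m`,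
  `|res - r(x)| ≤ γ₂ₘ₊₁(2u) r̃(|x|)`) in product form, started — as ALGORITHM 11 is — from
  `rₙ = 0` rather than from `r_m = fl*(a_m + b_m)` (`m = n - 1`; the model then charges one more
  rounding to the leading coefficient: `(1 + v)²ⁿ - 1 ≤ γ₂ₙ(v)`, where the printed proof of
  THEOREM 6.4 uses `(1 + 2u) γ₂ₙ₋₁(2u) ≤ γ₂ₙ(2u)`). LEMMA 6.3 itself, in the multiplicative model,
  is `LangloisLouvet2006.abs_hornerFl_perturbed_sub_sum_le_gamma` (= [LangloisLouvet2006]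
  LEMMA 1 eq. (7), with `u := 2u`) and is not re-stated.
* LEMMA 6.2 — `sum_abs_pi_add_abs_sigma_dir_le` (product form
  `(p_π + p_σ)~(x) ≤ (1 + v)((1 + v)²ⁿ - 1) p̃(x)`) and, AS PRINTED with `v = 2u`,
  `sum_abs_pi_add_abs_sigma_dir_le_gamma`: `Σ_{i<n} (|πᵢ| + |σᵢ|)|x|ⁱ ≤ γ₂ₙ₊₁(v) p̃(x)`.
* THEOREM 6.4, for ANY trace — `abs_compHornerDir_sub_sum_le` (product form
  `|res - p(x)| ≤ v|p(x)| + ((1 + v)²ⁿ⁺¹ - 1)² p̃(x)`), `abs_compHornerDir_sub_sum_le_gamma_sq`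
  (`≤ v|p(x)| + γ₂ₙ₊₁(v)² p̃(x)`: the printed proof bounds each of its two second-order terms by
  `γ₂ₙ₊₁(2u)² p̃(x)`; summed first they stay below one `γ₂ₙ₊₁(2u)² p̃(x)`), and AS PRINTED —
  `abs_compHornerDir_sub_sum_le_two_gamma_sq`:
  `|CompHorner(p, x) - p(x)| ≤ 2u|p(x)| + 2γ₂ₙ₊₁(2u)² p̃(x)`; the relative form printed in
  [GraillatJezequel2020, §6.2] — `abs_compHornerDir_sub_sum_div_le`.
* The same bounds LITERALLY for the executable model `GraillatJezequel2020.compHornerRd rd x a n`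
  (ALGORITHM 14 of [GraillatJezequel2020] = ALGORITHM 11 here, with `σᵢ = rd τᵢ` the model
  `FastTwoSum` correction) under `|rd t - t| ≤ v|t|` — `abs_compHornerRd_sub_sum_le`
  (`v|p(x)| + γ₂ₙ₊₁(v)² p̃(x)`), `abs_compHornerRd_sub_sum_le_two_gamma_sq` (PROPOSITION 6.2 of
  [GraillatJezequel2020] as printed, `v = 2u`) and `abs_compHornerRd_sub_sum_div_le` (its relative
  form); the level-`i` values `sᵢ`, `rᵢ` of that run are `compHornerRdHigh`, `compHornerRdLow`.

On the printed proof of THEOREM 6.4: its chain is `|res - p(x)| ≤ 2u|p(x)| + (1 + 2u)(|fl*(e(x))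
- e(x)| + |(p_τ - p_σ)(x)|)` (first display), LEMMA 6.3 + LEMMA 6.2 for the first term and
PROPOSITION 4.5 (`|τᵢ - σᵢ| ≤ 2u|τᵢ|`) for the second; the proofs below follow exactly this chain
with the model's product-form constants and reach the printed constant (indeed `γ₂ₙ₊₁(2u)²` in
place of `2γ₂ₙ₊₁(2u)²`). The printed bound `p̃_τ(|x|) ≤ 2nu γ₂ₙ(2u) p̃(|x|)` of that proof (by
(6.36) one gets `2nu(1 + γ₂ₙ(2u)) = γ₂ₙ(2u)/2`; immaterial to the theorem) is not used here: our
route to `p̃_τ` is eq. (11) of [LangloisLouvet2006], `(p_π + p_τ)~(x) ≤ ((1 + v)²ⁿ - 1) p̃(x)`,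
whence also LEMMA 6.2 by `|σᵢ| ≤ (1 + v)|τᵢ|`.

NOT formalised here: the format-level proofs of the hypotheses (eq. (2.2), §5.2, PROPOSITION
4.5), underflow, the dynamical control of [GraillatJezequelPicot2018, §3] (DSA / CADNA), and the
running-error / validated variants of [GraillatJezequel2020, §6] beyond PROPOSITION 6.2 (the
enclosure statements PROPOSITIONS 6.1 / 6.3 are `Higham2002/Horner.lean` and
`GraillatJezequel2020/CompensatedEnclosures.lean`).
-/

namespace Literature.ComputerArithmetic.GraillatJezequelPicot2018

open Finset Literature.ComputerArithmetic.Higham2002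
open Literature.ComputerArithmetic.LangloisLouvet2006
open Literature.ComputerArithmetic.GraillatJezequel2020

variable {K : Type*} [Field K] [LinearOrder K] [IsStrictOrderedRing K]

/-! ## Algorithm 11, line 6: the rounded Horner-type accumulation of the corrections -/

/-- ALGORITHM 11, LINES 2 AND 6 (`rₙ = 0`, `rᵢ ← rᵢ₊₁·x + (πᵢ + σᵢ)` with the three operations
rounded) as a rounded Horner-type accumulation of arbitrary coefficients `eᵢ` (in the algorithm
`eᵢ = πᵢ + σᵢ`): if `rₙ = 0`,
`|qᵢ - rᵢ₊₁ x| ≤ v|rᵢ₊₁ x|`, `|cᵢ - eᵢ| ≤ v|eᵢ|` and `|rᵢ - (qᵢ + cᵢ)| ≤ v|qᵢ + cᵢ|` for `i < n`,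
then `|r₀ - Σ_{i<n} eᵢ xⁱ| ≤ ((1 + v)²ⁿ - 1) Σ_{i<n} |eᵢ| |x|ⁱ`. This is the product form of
LEMMA 6.3 (the scheme `rᵢ ← fl*(rᵢ₊₁·x + (aᵢ + bᵢ))` for `r = p + q`, coefficients summed in
floating point: `|res - r(x)| ≤ γ₂ₘ₊₁(2u) r̃(|x|)` for degree `m`; the printed proof of
THEOREM 6.4 applies it to `e = p_π + p_σ`, `m = n - 1`) for the evaluation ALGORITHM 11
performs, which starts from `rₙ = 0` instead of `r_m = fl*(a_m + b_m)` — one more model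
rounding on the leading coefficient, `(1 + v)²ⁿ - 1 ≤ γ₂ₙ(v)` in place of `γ₂ₙ₋₁(2u)` (the
printed proof's next step is `(1 + 2u) γ₂ₙ₋₁(2u) ≤ γ₂ₙ(2u)` anyway). Induction on `n`, peeling
level `0`. [cite: GraillatJezequelPicot2018, §6.3 Algorithm 11, Lemma 6.3 and proof of
Theorem 6.4] -/
theorem abs_corrAcc_sub_sum_le {v : K} (hv : 0 ≤ v) (x : K) :
    ∀ (n : ℕ) (e r q c : ℕ → K), r n = 0 →
      (∀ i < n, |q i - r (i + 1) * x| ≤ v * |r (i + 1) * x|) →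
      (∀ i < n, |c i - e i| ≤ v * |e i|) → (∀ i < n, |r i - (q i + c i)| ≤ v * |q i + c i|) →
      |r 0 - ∑ i ∈ range n, e i * x ^ i| ≤ ((1 + v) ^ (2 * n) - 1) * ∑ i ∈ range n, |e i| * |x| ^ i
  | 0, e, r, q, c, hrn, _, _, _ => by simp [hrn]
  | n + 1, e, r, q, c, hrn, hq, hc, hr => by
      have ih := abs_corrAcc_sub_sum_le hv x n (fun i => e (i + 1)) (fun i => r (i + 1))
        (fun i => q (i + 1)) (fun i => c (i + 1)) hrn (fun i hi => hq (i + 1) (by omega))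
        (fun i hi => hc (i + 1) (by omega)) (fun i hi => hr (i + 1) (by omega))
      have hq0 := hq 0 (by omega)
      have hc0 := hc 0 (by omega)
      have hr0 := hr 0 (by omega)
      simp only [zero_add] at hq0 hr0
      rw [sum_mul_pow_le_of_horner_acc.sum_mul_pow_succ_eq' e x n,
        sum_mul_pow_le_of_horner_acc.sum_mul_pow_succ_eq' (fun i => |e i|) |x| n]
      set T := ∑ i ∈ range n, e (i + 1) * x ^ i with hT
      set Tt := ∑ i ∈ range n, |e (i + 1)| * |x| ^ i with hTt
      have hTt0 : 0 ≤ Tt := Finset.sum_nonneg fun _ _ => by positivity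
      have hx0 := abs_nonneg x
      have he0 := abs_nonneg (e 0)
      have hG : 1 ≤ (1 + v) ^ (2 * n) := one_le_pow₀ (by linarith)
      have hTabs : |T| ≤ Tt := by
        rw [hT, hTt]
        refine le_trans (Finset.abs_sum_le_sum_abs _ _) (le_of_eq (Finset.sum_congr rfl ?_))
        intro i _
        rw [abs_mul, abs_pow]
      have hr1 : |r 1| ≤ (1 + v) ^ (2 * n) * Tt := by
        have := abs_sub_abs_le_abs_sub (r 1) T
        linarith
      have hW : |r 1| * |x| ≤ (1 + v) ^ (2 * n) * Tt * |x| := mul_le_mul_of_nonneg_right hr1 hx0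
      have hq0' : |q 0| ≤ (1 + v) * (|r 1| * |x|) := by
        have h1 := abs_sub_abs_le_abs_sub (q 0) (r 1 * x)
        rw [abs_mul] at h1 hq0
        linarith
      have hc0' : |c 0| ≤ (1 + v) * |e 0| := by
        have h1 := abs_sub_abs_le_abs_sub (c 0) (e 0)
        linarith
      have key : r 0 - (T * x + e 0)
          = (r 0 - (q 0 + c 0)) + (q 0 - r 1 * x) + (c 0 - e 0) + (r 1 - T) * x := by ring
      rw [key]
      have hpow : (1 + v) ^ (2 * (n + 1)) = (1 + v) ^ (2 * n) * (1 + v) ^ 2 := by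
        rw [show 2 * (n + 1) = 2 * n + 2 by ring, pow_add]
      have j1 : v * |q 0| ≤ v * ((1 + v) * (|r 1| * |x|)) := mul_le_mul_of_nonneg_left hq0' hv
      have j2 : v * |c 0| ≤ v * ((1 + v) * |e 0|) := mul_le_mul_of_nonneg_left hc0' hv
      have j4 : (v * (1 + v) + v) * (|r 1| * |x|)
          ≤ (v * (1 + v) + v) * ((1 + v) ^ (2 * n) * Tt * |x|) :=
        mul_le_mul_of_nonneg_left hW (by positivity)
      have j5 : ((1 + v) ^ 2 - 1) * |e 0| ≤ ((1 + v) ^ (2 * n) * (1 + v) ^ 2 - 1) * |e 0| := by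
        apply mul_le_mul_of_nonneg_right _ he0
        have h1 : (1 + v) ^ 2 ≤ (1 + v) ^ (2 * n) * (1 + v) ^ 2 :=
          le_mul_of_one_le_left (by positivity) hG
        linarith
      calc |r 0 - (q 0 + c 0) + (q 0 - r 1 * x) + (c 0 - e 0) + (r 1 - T) * x|
          ≤ |r 0 - (q 0 + c 0)| + |q 0 - r 1 * x| + |c 0 - e 0| + |(r 1 - T) * x| := by
            have h1 := abs_add_le (r 0 - (q 0 + c 0) + (q 0 - r 1 * x) + (c 0 - e 0))
              ((r 1 - T) * x)
            have h2 := abs_add_le (r 0 - (q 0 + c 0) + (q 0 - r 1 * x)) (c 0 - e 0)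
            have h3 := abs_add_le (r 0 - (q 0 + c 0)) (q 0 - r 1 * x)
            linarith
        _ ≤ v * (|q 0| + |c 0|) + v * (|r 1| * |x|) + v * |e 0|
              + ((1 + v) ^ (2 * n) - 1) * Tt * |x| := by
            have i1 : |r 0 - (q 0 + c 0)| ≤ v * (|q 0| + |c 0|) :=
              le_trans hr0 (mul_le_mul_of_nonneg_left (abs_add_le _ _) hv)
            have i2 : |q 0 - r 1 * x| ≤ v * (|r 1| * |x|) := by rw [← abs_mul]; exact hq0
            have i4 : |(r 1 - T) * x| ≤ ((1 + v) ^ (2 * n) - 1) * Tt * |x| := by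
              rw [abs_mul]; exact mul_le_mul_of_nonneg_right ih hx0
            linarith [hc0]
        _ ≤ ((1 + v) ^ (2 * n) * (1 + v) ^ 2 - 1) * (Tt * |x| + |e 0|) := by
            linarith [j1, j2, j4, j5]
        _ = ((1 + v) ^ (2 * (n + 1)) - 1) * (Tt * |x| + |e 0|) := by rw [hpow]

/-! ## Lemma 6.2: the computed correction polynomials `p_π`, `p_σ` -/

/-- LEMMA 6.2, product form, for ANY trace of lines 1, 4, 5 of ALGORITHM 11 under the model
(`sₙ = aₙ`,
`sᵢ₊₁ x = pᵢ + πᵢ`, `pᵢ + aᵢ = sᵢ + τᵢ`, `|πᵢ| ≤ v|sᵢ₊₁ x|`, `|τᵢ| ≤ v|pᵢ + aᵢ|`, and the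
computed `FastTwoSum` correction `σᵢ` with `|σᵢ - τᵢ| ≤ v|τᵢ|`, PROPOSITION 4.5):
`(p_π + p_σ)~(x) = Σ_{i<n} (|πᵢ| + |σᵢ|)|x|ⁱ ≤ (1 + v)((1 + v)²ⁿ - 1) p̃(x)` — from
[LangloisLouvet2006] eq. (11), `(p_π + p_τ)~(x) ≤ ((1 + v)²ⁿ - 1) p̃(x)`, and `|σᵢ| ≤ (1 + v)|τᵢ|`.
[cite: GraillatJezequelPicot2018, §6.3 Lemma 6.2 and its proof] -/
theorem sum_abs_pi_add_abs_sigma_dir_le {v : K} (hv : 0 ≤ v) (x : K) (n : ℕ)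
    (a s p π τ σ : ℕ → K) (hsn : s n = a n) (hprod : ∀ i < n, s (i + 1) * x = p i + π i)
    (hsum : ∀ i < n, p i + a i = s i + τ i) (hπ : ∀ i < n, |π i| ≤ v * |s (i + 1) * x|)
    (hτ : ∀ i < n, |τ i| ≤ v * |p i + a i|) (hσ : ∀ i < n, |σ i - τ i| ≤ v * |τ i|) :
    ∑ i ∈ range n, (|π i| + |σ i|) * |x| ^ i
      ≤ (1 + v) * ((1 + v) ^ (2 * n) - 1) * ∑ i ∈ range (n + 1), |a i| * |x| ^ i := by
  have h1 := sum_abs_pi_add_abs_sigma_le hv x n a s p π τ hsn hprod hsum hπ hτ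
  have hστ : ∀ i < n, |σ i| ≤ (1 + v) * |τ i| := fun i hi => by
    calc |σ i| = |τ i + (σ i - τ i)| := by congr 1; ring
      _ ≤ |τ i| + |σ i - τ i| := abs_add_le _ _
      _ ≤ |τ i| + v * |τ i| := by linarith [hσ i hi]
      _ = (1 + v) * |τ i| := by ring
  have h2 : ∑ i ∈ range n, (|π i| + |σ i|) * |x| ^ i
      ≤ (1 + v) * ∑ i ∈ range n, (|π i| + |τ i|) * |x| ^ i := by
    rw [Finset.mul_sum]
    refine Finset.sum_le_sum fun i hi => ?_
    have hi' := Finset.mem_range.mp hi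
    have hπi : |π i| ≤ (1 + v) * |π i| := le_mul_of_one_le_left (abs_nonneg _) (by linarith)
    calc (|π i| + |σ i|) * |x| ^ i ≤ ((1 + v) * |π i| + (1 + v) * |τ i|) * |x| ^ i :=
          mul_le_mul_of_nonneg_right (add_le_add hπi (hστ i hi')) (by positivity)
      _ = (1 + v) * ((|π i| + |τ i|) * |x| ^ i) := by ring
  calc ∑ i ∈ range n, (|π i| + |σ i|) * |x| ^ i
      ≤ (1 + v) * ∑ i ∈ range n, (|π i| + |τ i|) * |x| ^ i := h2
    _ ≤ (1 + v) * (((1 + v) ^ (2 * n) - 1) * ∑ i ∈ range (n + 1), |a i| * |x| ^ i) :=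
        mul_le_mul_of_nonneg_left h1 (by linarith)
    _ = (1 + v) * ((1 + v) ^ (2 * n) - 1) * ∑ i ∈ range (n + 1), |a i| * |x| ^ i := by ring

/-- LEMMA 6.2 AS PRINTED (`v = 2u`, `(2n + 1) v < 1`): "Let `p(x) = Σ_{i=0}^{n} aᵢ xⁱ` a
polynomial with `aᵢ ∈ F`, `0 ≤ i ≤ n` and `x ∈ F`. Let `p_π` and `p_σ` be defined by (6.33) and
(6.34). Then, we have `p̃_π(|x|) + p̃_σ(|x|) ≤ γ₂ₙ₊₁(2u) p̃(|x|)`" — i.e.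
`Σ_{i<n} (|πᵢ| + |σᵢ|)|x|ⁱ ≤ γ₂ₙ₊₁(v) Σ_{i<n+1} |aᵢ| |x|ⁱ`, for any trace as in
`sum_abs_pi_add_abs_sigma_dir_le`, since `(1 + v)((1 + v)²ⁿ - 1) = ((1 + v)²ⁿ⁺¹ - 1) - v
≤ γ₂ₙ₊₁(v)`. [cite: GraillatJezequelPicot2018, §6.3 Lemma 6.2] -/
theorem sum_abs_pi_add_abs_sigma_dir_le_gamma {v : K} (hv : 0 ≤ v) {n : ℕ}
    (hn : ((2 * n + 1 : ℕ) : K) * v < 1) (x : K) (a s p π τ σ : ℕ → K) (hsn : s n = a n)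
    (hprod : ∀ i < n, s (i + 1) * x = p i + π i) (hsum : ∀ i < n, p i + a i = s i + τ i)
    (hπ : ∀ i < n, |π i| ≤ v * |s (i + 1) * x|) (hτ : ∀ i < n, |τ i| ≤ v * |p i + a i|)
    (hσ : ∀ i < n, |σ i - τ i| ≤ v * |τ i|) :
    ∑ i ∈ range n, (|π i| + |σ i|) * |x| ^ i
      ≤ gamma v (2 * n + 1) * ∑ i ∈ range (n + 1), |a i| * |x| ^ i := by
  have h := sum_abs_pi_add_abs_sigma_dir_le hv x n a s p π τ σ hsn hprod hsum hπ hτ hσ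
  have hS0 : 0 ≤ ∑ i ∈ range (n + 1), |a i| * |x| ^ i :=
    Finset.sum_nonneg fun _ _ => by positivity
  have h1 : (1 + v) * ((1 + v) ^ (2 * n) - 1) ≤ gamma v (2 * n + 1) := by
    have e : (1 + v) * ((1 + v) ^ (2 * n) - 1) = ((1 + v) ^ (2 * n + 1) - 1) - v := by
      rw [pow_succ]; ring
    rw [e]
    linarith [one_add_pow_sub_one_le_gamma hv hn]
  exact le_trans h (mul_le_mul_of_nonneg_right h1 hS0)

/-! ## Theorem 6.4: accuracy of `CompHorner` under a directed rounding -/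

/-- THEOREM 6.4, product form, for ANY trace of ALGORITHM 11 under the model (hypotheses as in
the module docstring; `res = fl(s₀ + r₀)`, line 8):
`|res - p(x)| ≤ v|p(x)| + ((1 + v)²ⁿ⁺¹ - 1)² p̃(x)`.
Proof = the printed chain: `res - p(x) = (res - (s₀ + r₀)) + (r₀ - e(x)) + (p_σ - p_τ)(x)`
with `e = p_π + p_σ` (eq. (6.33)), so `|res - p(x)| ≤ v|p(x)| + (1 + v)(|r₀ - e(x)|
+ |(p_σ - p_τ)(x)|)`; then `abs_corrAcc_sub_sum_le` with LEMMA 6.2 for the first term,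
`|σᵢ - τᵢ| ≤ v|τᵢ|` with [LangloisLouvet2006] eq. (11) for the second, and
`(1 + v)(Q - 1)((1 + v)(Q - 1) + v) = (R - v)R ≤ R²` (`Q = (1 + v)²ⁿ`, `R = (1 + v)²ⁿ⁺¹ - 1`).
[cite: GraillatJezequelPicot2018, §6.3 Theorem 6.4 and its proof] -/
theorem abs_compHornerDir_sub_sum_le {v : K} (hv : 0 ≤ v) (x : K) (n : ℕ)
    (a s p π τ σ r q c : ℕ → K) (res : K) (hsn : s n = a n)
    (hprod : ∀ i < n, s (i + 1) * x = p i + π i) (hsum : ∀ i < n, p i + a i = s i + τ i)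
    (hπ : ∀ i < n, |π i| ≤ v * |s (i + 1) * x|) (hτ : ∀ i < n, |τ i| ≤ v * |p i + a i|)
    (hσ : ∀ i < n, |σ i - τ i| ≤ v * |τ i|) (hrn : r n = 0)
    (hq : ∀ i < n, |q i - r (i + 1) * x| ≤ v * |r (i + 1) * x|)
    (hc : ∀ i < n, |c i - (π i + σ i)| ≤ v * |π i + σ i|)
    (hr : ∀ i < n, |r i - (q i + c i)| ≤ v * |q i + c i|)
    (hres : |res - (s 0 + r 0)| ≤ v * |s 0 + r 0|) :
    |res - ∑ i ∈ range (n + 1), a i * x ^ i|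
      ≤ v * |∑ i ∈ range (n + 1), a i * x ^ i|
        + ((1 + v) ^ (2 * n + 1) - 1) ^ 2 * ∑ i ∈ range (n + 1), |a i| * |x| ^ i := by
  set P := ∑ i ∈ range (n + 1), a i * x ^ i with hP
  set S := ∑ i ∈ range (n + 1), |a i| * |x| ^ i with hS
  set cs := ∑ i ∈ range n, (π i + τ i) * x ^ i with hcs
  set cc := ∑ i ∈ range n, (π i + σ i) * x ^ i with hcc
  have hS0 : 0 ≤ S := Finset.sum_nonneg fun _ _ => by positivity
  have hQ1 : 1 ≤ (1 + v) ^ (2 * n) := one_le_pow₀ (by linarith)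
  have hid : s 0 + cs = P := eftHorner_add_sum_eq x n a s p π τ hsn hprod hsum
  have hE := sum_abs_pi_add_abs_sigma_le hv x n a s p π τ hsn hprod hsum hπ hτ
  have hL62 := sum_abs_pi_add_abs_sigma_dir_le hv x n a s p π τ σ hsn hprod hsum hπ hτ hσ
  have hA0 := abs_corrAcc_sub_sum_le hv x n (fun i => π i + σ i) r q c hrn hq hc hr
  have hct : ∑ i ∈ range n, |π i + σ i| * |x| ^ i ≤ (1 + v) * ((1 + v) ^ (2 * n) - 1) * S :=
    le_trans (Finset.sum_le_sum fun i _ =>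
      mul_le_mul_of_nonneg_right (abs_add_le _ _) (by positivity)) hL62
  have hA : |r 0 - cc| ≤ ((1 + v) ^ (2 * n) - 1) * ((1 + v) * ((1 + v) ^ (2 * n) - 1) * S) :=
    le_trans hA0 (mul_le_mul_of_nonneg_left hct (by linarith))
  have hB : |cc - cs| ≤ v * (((1 + v) ^ (2 * n) - 1) * S) := by
    rw [hcc, hcs, ← Finset.sum_sub_distrib]
    calc |∑ i ∈ range n, ((π i + σ i) * x ^ i - (π i + τ i) * x ^ i)|
        ≤ ∑ i ∈ range n, |(π i + σ i) * x ^ i - (π i + τ i) * x ^ i| :=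
          Finset.abs_sum_le_sum_abs _ _
      _ ≤ ∑ i ∈ range n, v * ((|π i| + |τ i|) * |x| ^ i) := Finset.sum_le_sum fun i hi => by
          have hi' := Finset.mem_range.mp hi
          rw [show (π i + σ i) * x ^ i - (π i + τ i) * x ^ i = (σ i - τ i) * x ^ i by ring,
            abs_mul, abs_pow]
          have hxi : 0 ≤ |x| ^ i := by positivity
          calc |σ i - τ i| * |x| ^ i ≤ v * |τ i| * |x| ^ i :=
                mul_le_mul_of_nonneg_right (hσ i hi') hxi
            _ ≤ v * ((|π i| + |τ i|) * |x| ^ i) := by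
                have h1 : v * |τ i| ≤ v * (|π i| + |τ i|) :=
                  mul_le_mul_of_nonneg_left (by linarith [abs_nonneg (π i)]) hv
                nlinarith [mul_le_mul_of_nonneg_right h1 hxi]
      _ = v * ∑ i ∈ range n, (|π i| + |τ i|) * |x| ^ i := by rw [Finset.mul_sum]
      _ ≤ v * (((1 + v) ^ (2 * n) - 1) * S) := mul_le_mul_of_nonneg_left hE hv
  have key : res - P = (res - (s 0 + r 0)) + (r 0 - cc) + (cc - cs) := by rw [← hid]; ring
  have hsr : |s 0 + r 0| ≤ |P| + |r 0 - cc| + |cc - cs| := by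
    have e : s 0 + r 0 = P + (r 0 - cc) + (cc - cs) := by rw [← hid]; ring
    rw [e]
    have h1 := abs_add_le (P + (r 0 - cc)) (cc - cs)
    have h2 := abs_add_le P (r 0 - cc)
    linarith
  have hres' : |res - (s 0 + r 0)| ≤ v * (|P| + |r 0 - cc| + |cc - cs|) :=
    le_trans hres (mul_le_mul_of_nonneg_left hsr hv)
  have hfin : (1 + v) * (((1 + v) ^ (2 * n) - 1) * ((1 + v) * ((1 + v) ^ (2 * n) - 1) * S)
        + v * (((1 + v) ^ (2 * n) - 1) * S))
      ≤ ((1 + v) ^ (2 * n + 1) - 1) ^ 2 * S := by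
    rw [show (1 + v) ^ (2 * n + 1) = (1 + v) ^ (2 * n) * (1 + v) from pow_succ _ _]
    have hRv : 0 ≤ (1 + v) ^ (2 * n) * (1 + v) - 1 := by
      nlinarith [mul_nonneg (zero_le_one.trans hQ1) hv]
    nlinarith [mul_nonneg (mul_nonneg hv hS0) hRv]
  rw [key]
  calc |res - (s 0 + r 0) + (r 0 - cc) + (cc - cs)|
      ≤ |res - (s 0 + r 0)| + |r 0 - cc| + |cc - cs| := by
        have h1 := abs_add_le (res - (s 0 + r 0) + (r 0 - cc)) (cc - cs)
        have h2 := abs_add_le (res - (s 0 + r 0)) (r 0 - cc)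
        linarith
    _ ≤ v * (|P| + |r 0 - cc| + |cc - cs|) + |r 0 - cc| + |cc - cs| := by linarith [hres']
    _ = v * |P| + (1 + v) * (|r 0 - cc| + |cc - cs|) := by ring
    _ ≤ v * |P| + (1 + v) * (((1 + v) ^ (2 * n) - 1) * ((1 + v) * ((1 + v) ^ (2 * n) - 1) * S)
          + v * (((1 + v) ^ (2 * n) - 1) * S)) := by
        have h1v : 0 ≤ 1 + v := by linarith
        linarith [mul_le_mul_of_nonneg_left (add_le_add hA hB) h1v]
    _ ≤ v * |P| + ((1 + v) ^ (2 * n + 1) - 1) ^ 2 * S := by linarith [hfin]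

/-- THEOREM 6.4, `γ` form, for ANY trace (`(2n + 1) v < 1`): `|res - p(x)| ≤ v|p(x)|
+ γ₂ₙ₊₁(v)² p̃(x)` — `(1 + v)²ⁿ⁺¹ - 1 ≤ γ₂ₙ₊₁(v)` ([Higham2002ASNA] Lemma 3.1). With `v = 2u`
this is the printed bound with `γ₂ₙ₊₁(2u)²` in place of `2γ₂ₙ₊₁(2u)²` (the printed proof bounds
its two second-order terms by `γ₂ₙ₊₁(2u)² p̃(x)` each; here they are summed first,
`(R - v)R ≤ R²`); the statement AS PRINTED is `abs_compHornerDir_sub_sum_le_two_gamma_sq`.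
[cite: GraillatJezequelPicot2018, §6.3 Theorem 6.4 and its proof] -/
theorem abs_compHornerDir_sub_sum_le_gamma_sq {v : K} (hv : 0 ≤ v) {n : ℕ}
    (hn : ((2 * n + 1 : ℕ) : K) * v < 1) (x : K) (a s p π τ σ r q c : ℕ → K) (res : K)
    (hsn : s n = a n) (hprod : ∀ i < n, s (i + 1) * x = p i + π i)
    (hsum : ∀ i < n, p i + a i = s i + τ i) (hπ : ∀ i < n, |π i| ≤ v * |s (i + 1) * x|)
    (hτ : ∀ i < n, |τ i| ≤ v * |p i + a i|) (hσ : ∀ i < n, |σ i - τ i| ≤ v * |τ i|)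
    (hrn : r n = 0) (hq : ∀ i < n, |q i - r (i + 1) * x| ≤ v * |r (i + 1) * x|)
    (hc : ∀ i < n, |c i - (π i + σ i)| ≤ v * |π i + σ i|)
    (hr : ∀ i < n, |r i - (q i + c i)| ≤ v * |q i + c i|)
    (hres : |res - (s 0 + r 0)| ≤ v * |s 0 + r 0|) :
    |res - ∑ i ∈ range (n + 1), a i * x ^ i|
      ≤ v * |∑ i ∈ range (n + 1), a i * x ^ i|
        + gamma v (2 * n + 1) ^ 2 * ∑ i ∈ range (n + 1), |a i| * |x| ^ i := by
  have h := abs_compHornerDir_sub_sum_le hv x n a s p π τ σ r q c res hsn hprod hsum hπ hτ hσ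
    hrn hq hc hr hres
  have hR0 : 0 ≤ (1 + v) ^ (2 * n + 1) - 1 := by
    have := one_le_pow₀ (M₀ := K) (a := 1 + v) (by linarith) (n := 2 * n + 1)
    linarith
  have hsq : ((1 + v) ^ (2 * n + 1) - 1) ^ 2 ≤ gamma v (2 * n + 1) ^ 2 :=
    pow_le_pow_left₀ hR0 (one_add_pow_sub_one_le_gamma hv hn) 2
  exact le_trans h (add_le_add le_rfl (mul_le_mul_of_nonneg_right hsq
    (Finset.sum_nonneg fun _ _ => by positivity)))

/-- THEOREM 6.4 AS PRINTED (`u ≥ 0` the unit roundoff, one directed-rounded operation modelled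
by `|fl(t) - t| ≤ 2u|t|`, `(2n + 1)(2u) < 1`): "Consider a polynomial `p` of degree `n` with
floating-point coefficients, and a floating-point value `x`. With directed rounding, the forward
error in the compensated Horner algorithm is such that
`|CompHorner(p, x) - p(x)| ≤ 2u|p(x)| + 2γ₂ₙ₊₁(2u)² p̃(x)`" — for ANY trace of ALGORITHM 11;
also PROPOSITION 6.2 of [GraillatJezequel2020].
[cite: GraillatJezequelPicot2018, §6.3 Theorem 6.4] [cite: GraillatJezequel2020, §6.2
Proposition 6.2] -/
theorem abs_compHornerDir_sub_sum_le_two_gamma_sq {u : K} (hu : 0 ≤ u) {n : ℕ}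
    (hn : ((2 * n + 1 : ℕ) : K) * (2 * u) < 1) (x : K) (a s p π τ σ r q c : ℕ → K) (res : K)
    (hsn : s n = a n) (hprod : ∀ i < n, s (i + 1) * x = p i + π i)
    (hsum : ∀ i < n, p i + a i = s i + τ i) (hπ : ∀ i < n, |π i| ≤ 2 * u * |s (i + 1) * x|)
    (hτ : ∀ i < n, |τ i| ≤ 2 * u * |p i + a i|) (hσ : ∀ i < n, |σ i - τ i| ≤ 2 * u * |τ i|)
    (hrn : r n = 0) (hq : ∀ i < n, |q i - r (i + 1) * x| ≤ 2 * u * |r (i + 1) * x|)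
    (hc : ∀ i < n, |c i - (π i + σ i)| ≤ 2 * u * |π i + σ i|)
    (hr : ∀ i < n, |r i - (q i + c i)| ≤ 2 * u * |q i + c i|)
    (hres : |res - (s 0 + r 0)| ≤ 2 * u * |s 0 + r 0|) :
    |res - ∑ i ∈ range (n + 1), a i * x ^ i|
      ≤ 2 * u * |∑ i ∈ range (n + 1), a i * x ^ i|
        + 2 * gamma (2 * u) (2 * n + 1) ^ 2 * ∑ i ∈ range (n + 1), |a i| * |x| ^ i := by
  have hv : (0 : K) ≤ 2 * u := by positivity
  have h := abs_compHornerDir_sub_sum_le_gamma_sq hv hn x a s p π τ σ r q c res hsn hprod hsum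
    hπ hτ hσ hrn hq hc hr hres
  have hS0 : 0 ≤ ∑ i ∈ range (n + 1), |a i| * |x| ^ i :=
    Finset.sum_nonneg fun _ _ => by positivity
  nlinarith [mul_nonneg (sq_nonneg (gamma (2 * u) (2 * n + 1))) hS0]

/-- THEOREM 6.4 / PROPOSITION 6.2 of [GraillatJezequel2020], relative form as printed there:
`|CompHorner(p, x) - p(x)| / |p(x)| ≤ 2u + 2γ₂ₙ₊₁(2u)² cond(p, x)` (both sides `0` when
`p(x) = 0`), for ANY trace of ALGORITHM 11.
[cite: GraillatJezequel2020, §6.2 Proposition 6.2] [cite: GraillatJezequelPicot2018, §6.3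
Theorem 6.4] -/
theorem abs_compHornerDir_sub_sum_div_le {u : K} (hu : 0 ≤ u) {n : ℕ}
    (hn : ((2 * n + 1 : ℕ) : K) * (2 * u) < 1) (x : K) (a s p π τ σ r q c : ℕ → K) (res : K)
    (hsn : s n = a n) (hprod : ∀ i < n, s (i + 1) * x = p i + π i)
    (hsum : ∀ i < n, p i + a i = s i + τ i) (hπ : ∀ i < n, |π i| ≤ 2 * u * |s (i + 1) * x|)
    (hτ : ∀ i < n, |τ i| ≤ 2 * u * |p i + a i|) (hσ : ∀ i < n, |σ i - τ i| ≤ 2 * u * |τ i|)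
    (hrn : r n = 0) (hq : ∀ i < n, |q i - r (i + 1) * x| ≤ 2 * u * |r (i + 1) * x|)
    (hc : ∀ i < n, |c i - (π i + σ i)| ≤ 2 * u * |π i + σ i|)
    (hr : ∀ i < n, |r i - (q i + c i)| ≤ 2 * u * |q i + c i|)
    (hres : |res - (s 0 + r 0)| ≤ 2 * u * |s 0 + r 0|) :
    |res - ∑ i ∈ range (n + 1), a i * x ^ i| / |∑ i ∈ range (n + 1), a i * x ^ i|
      ≤ 2 * u + 2 * gamma (2 * u) (2 * n + 1) ^ 2 * condPoly a x n := by
  have h := abs_compHornerDir_sub_sum_le_two_gamma_sq hu hn x a s p π τ σ r q c res hsn hprod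
    hsum hπ hτ hσ hrn hq hc hr hres
  unfold condPoly
  set P := ∑ i ∈ range (n + 1), a i * x ^ i
  set S := ∑ i ∈ range (n + 1), |a i| * |x| ^ i
  rcases eq_or_lt_of_le (abs_nonneg P) with hP | hP
  · rw [← hP]
    simp only [div_zero, mul_zero, add_zero]
    positivity
  · rw [div_le_iff₀ hP]
    have e : (2 * u + 2 * gamma (2 * u) (2 * n + 1) ^ 2 * (S / |P|)) * |P|
        = 2 * u * |P| + 2 * gamma (2 * u) (2 * n + 1) ^ 2 * S := by
      field_simp
    rw [e]
    exact h

/-! ## The bound literally, for the executable model `GraillatJezequel2020.compHornerRd` -/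

/-- The level-`i` high part `sᵢ` (`i ≤ n`) of the run `GraillatJezequel2020.compHornerRd rd x a n`
(ALGORITHM 14 of [GraillatJezequel2020] / ALGORITHM 11 here, lines 1, 4, 5): `sₙ = aₙ` and
`sᵢ = rd (rd (sᵢ₊₁ x) + aᵢ)`, i.e. `sᵢ = hornerRd rd x (aᵢ, …, aₙ) (n - i)` (ALGORITHM 12,
`Horner`, on the tail); junk (`a₀`) for `i > n`.
[cite: GraillatJezequel2020, §6.1 Algorithm 12; §6.2 Algorithm 14]
[cite: GraillatJezequelPicot2018, §6.3 Algorithms 10–11] -/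
def compHornerRdHigh (rd : K → K) (x : K) : (ℕ → K) → ℕ → ℕ → K
  | a, 0, _ => a 0
  | a, n + 1, 0 => hornerRd rd x a (n + 1)
  | a, n + 1, i + 1 => compHornerRdHigh rd x (fun j => a (j + 1)) n i

/-- The level-`i` accumulated correction `rᵢ` (`i ≤ n`) of the run
`GraillatJezequel2020.compHornerRd rd x a n`: `rₙ = 0` and
`rᵢ = rd (rd (rᵢ₊₁ x) + rd (πᵢ + σᵢ))` with `πᵢ = sᵢ₊₁ x - rd (sᵢ₊₁ x)` (`TwoProdFMA`, exact) and
`σᵢ = rd τᵢ`, `τᵢ = rd (sᵢ₊₁ x) + aᵢ - sᵢ` (the model `FastTwoSum` correction), i.e.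
`rᵢ = compHornerRdCorr rd x (aᵢ, …, aₙ) (n - i)` (lines 2, 6); `0` for `i > n`.
[cite: GraillatJezequel2020, §6.2 Algorithm 14] [cite: GraillatJezequelPicot2018, §6.3
Algorithm 11] -/
def compHornerRdLow (rd : K → K) (x : K) : (ℕ → K) → ℕ → ℕ → K
  | _, 0, _ => 0
  | a, n + 1, 0 => compHornerRdCorr rd x a (n + 1)
  | a, n + 1, i + 1 => compHornerRdLow rd x (fun j => a (j + 1)) n i

omit [LinearOrder K] [IsStrictOrderedRing K] in
/-- `s₀ = hornerRd rd x a n` (`Horner(p, x)`, the high part entering line 8 of ALGORITHM 14).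
[cite: GraillatJezequel2020, §6.1 Algorithm 12; §6.2 Algorithm 14] -/
theorem compHornerRdHigh_zero (rd : K → K) (x : K) :
    ∀ (n : ℕ) (a : ℕ → K), compHornerRdHigh rd x a n 0 = hornerRd rd x a n
  | 0, _ => rfl
  | _ + 1, _ => rfl

omit [LinearOrder K] [IsStrictOrderedRing K] in
/-- `sₙ = aₙ` (line 1 of ALGORITHM 14). [cite: GraillatJezequel2020, §6.2 Algorithm 14] -/
theorem compHornerRdHigh_self (rd : K → K) (x : K) :
    ∀ (n : ℕ) (a : ℕ → K), compHornerRdHigh rd x a n n = a n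
  | 0, _ => rfl
  | n + 1, a => by
      show compHornerRdHigh rd x (fun j => a (j + 1)) n n = a (n + 1)
      exact compHornerRdHigh_self rd x n _

omit [LinearOrder K] [IsStrictOrderedRing K] in
/-- Lines 4–5 of ALGORITHM 14 at level `i < n`, high parts: `sᵢ = rd (rd (sᵢ₊₁ x) + aᵢ)`.
[cite: GraillatJezequel2020, §6.2 Algorithm 14] -/
theorem compHornerRdHigh_step (rd : K → K) (x : K) :
    ∀ (n : ℕ) (a : ℕ → K) (i : ℕ), i < n →
      compHornerRdHigh rd x a n i = rd (rd (compHornerRdHigh rd x a n (i + 1) * x) + a i)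
  | 0, _, _, hi => absurd hi (Nat.not_lt_zero _)
  | n + 1, a, 0, _ => by
      show hornerRd rd x a (n + 1)
        = rd (rd (compHornerRdHigh rd x (fun j => a (j + 1)) n 0 * x) + a 0)
      rw [compHornerRdHigh_zero]
      rfl
  | n + 1, a, i + 1, hi => by
      show compHornerRdHigh rd x (fun j => a (j + 1)) n i
        = rd (rd (compHornerRdHigh rd x (fun j => a (j + 1)) n (i + 1) * x) + a (i + 1))
      exact compHornerRdHigh_step rd x n (fun j => a (j + 1)) i (by omega)

omit [LinearOrder K] [IsStrictOrderedRing K] in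
/-- `r₀ = compHornerRdCorr rd x a n` (the accumulated correction entering line 8 of
ALGORITHM 14). [cite: GraillatJezequel2020, §6.2 Algorithm 14] -/
theorem compHornerRdLow_zero (rd : K → K) (x : K) :
    ∀ (n : ℕ) (a : ℕ → K), compHornerRdLow rd x a n 0 = compHornerRdCorr rd x a n
  | 0, _ => rfl
  | _ + 1, _ => rfl

omit [LinearOrder K] [IsStrictOrderedRing K] in
/-- `rₙ = 0` (line 2 of ALGORITHM 14). [cite: GraillatJezequel2020, §6.2 Algorithm 14] -/
theorem compHornerRdLow_self (rd : K → K) (x : K) :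
    ∀ (n : ℕ) (a : ℕ → K), compHornerRdLow rd x a n n = 0
  | 0, _ => rfl
  | n + 1, a => by
      show compHornerRdLow rd x (fun j => a (j + 1)) n n = 0
      exact compHornerRdLow_self rd x n _

omit [LinearOrder K] [IsStrictOrderedRing K] in
/-- Lines 4–6 of ALGORITHM 14 at level `i < n`: with `t = sᵢ₊₁ x`,
`rᵢ = rd (rd (rᵢ₊₁ x) + rd ((t - rd t) + rd (rd t + aᵢ - rd (rd t + aᵢ))))`.
[cite: GraillatJezequel2020, §6.2 Algorithm 14] -/
theorem compHornerRdLow_step (rd : K → K) (x : K) :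
    ∀ (n : ℕ) (a : ℕ → K) (i : ℕ), i < n →
      compHornerRdLow rd x a n i
        = rd (rd (compHornerRdLow rd x a n (i + 1) * x)
            + rd ((compHornerRdHigh rd x a n (i + 1) * x
                    - rd (compHornerRdHigh rd x a n (i + 1) * x))
                + rd (rd (compHornerRdHigh rd x a n (i + 1) * x) + a i
                    - rd (rd (compHornerRdHigh rd x a n (i + 1) * x) + a i))))
  | 0, _, _, hi => absurd hi (Nat.not_lt_zero _)
  | n + 1, a, 0, _ => by
      show compHornerRdCorr rd x a (n + 1)
        = rd (rd (compHornerRdLow rd x (fun j => a (j + 1)) n 0 * x)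
            + rd ((compHornerRdHigh rd x (fun j => a (j + 1)) n 0 * x
                    - rd (compHornerRdHigh rd x (fun j => a (j + 1)) n 0 * x))
                + rd (rd (compHornerRdHigh rd x (fun j => a (j + 1)) n 0 * x) + a 0
                    - rd (rd (compHornerRdHigh rd x (fun j => a (j + 1)) n 0 * x) + a 0))))
      rw [compHornerRdLow_zero, compHornerRdHigh_zero]
      rfl
  | n + 1, a, i + 1, hi => by
      show compHornerRdLow rd x (fun j => a (j + 1)) n i = _
      exact compHornerRdLow_step rd x n (fun j => a (j + 1)) i (by omega)

/-- THEOREM 6.4 / [GraillatJezequel2020] PROPOSITION 6.2 LITERALLY for the executable model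
`GraillatJezequel2020.compHornerRd rd x a n` under `|rd t - t| ≤ v|t|` (`(2n + 1) v < 1`):
`|compHornerRd rd x a n - p(x)| ≤ v|p(x)| + γ₂ₙ₊₁(v)² p̃(x)` —
`abs_compHornerDir_sub_sum_le_gamma_sq` applied to the trace `sᵢ = compHornerRdHigh …`,
`rᵢ = compHornerRdLow …`, `pᵢ = rd (sᵢ₊₁ x)`, `πᵢ = sᵢ₊₁ x - pᵢ`, `τᵢ = pᵢ + aᵢ - sᵢ`, `σᵢ = rd τᵢ`,
`qᵢ = rd (rᵢ₊₁ x)`, `cᵢ = rd (πᵢ + σᵢ)`.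
[cite: GraillatJezequel2020, §6.2 Proposition 6.2] [cite: GraillatJezequelPicot2018, §6.3
Theorem 6.4] -/
theorem abs_compHornerRd_sub_sum_le {rd : K → K} {v : K} (hv : 0 ≤ v)
    (hacc : ∀ t, |rd t - t| ≤ v * |t|) {n : ℕ} (hn : ((2 * n + 1 : ℕ) : K) * v < 1) (x : K)
    (a : ℕ → K) :
    |compHornerRd rd x a n - ∑ i ∈ range (n + 1), a i * x ^ i|
      ≤ v * |∑ i ∈ range (n + 1), a i * x ^ i|
        + gamma v (2 * n + 1) ^ 2 * ∑ i ∈ range (n + 1), |a i| * |x| ^ i := by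
  have hacc' : ∀ t, |t - rd t| ≤ v * |t| := fun t => by rw [abs_sub_comm]; exact hacc t
  exact abs_compHornerDir_sub_sum_le_gamma_sq hv hn x a
    (fun i => compHornerRdHigh rd x a n i)
    (fun i => rd (compHornerRdHigh rd x a n (i + 1) * x))
    (fun i => compHornerRdHigh rd x a n (i + 1) * x - rd (compHornerRdHigh rd x a n (i + 1) * x))
    (fun i => rd (compHornerRdHigh rd x a n (i + 1) * x) + a i - compHornerRdHigh rd x a n i)
    (fun i => rd (rd (compHornerRdHigh rd x a n (i + 1) * x) + a i
      - compHornerRdHigh rd x a n i))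
    (fun i => compHornerRdLow rd x a n i)
    (fun i => rd (compHornerRdLow rd x a n (i + 1) * x))
    (fun i => rd ((compHornerRdHigh rd x a n (i + 1) * x
        - rd (compHornerRdHigh rd x a n (i + 1) * x))
      + rd (rd (compHornerRdHigh rd x a n (i + 1) * x) + a i - compHornerRdHigh rd x a n i)))
    (compHornerRd rd x a n) (compHornerRdHigh_self rd x n a)
    (fun i _ => by ring) (fun i _ => by ring)
    (fun i _ => hacc' _)
    (fun i hi => by rw [compHornerRdHigh_step rd x n a i hi]; exact hacc' _)
    (fun i _ => hacc _) (compHornerRdLow_self rd x n a) (fun i _ => hacc _) (fun i _ => hacc _)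
    (fun i hi => by
      rw [compHornerRdLow_step rd x n a i hi, compHornerRdHigh_step rd x n a i hi]
      exact hacc _)
    (by rw [compHornerRdHigh_zero, compHornerRdLow_zero]; exact hacc _)

/-- PROPOSITION 6.2 of [GraillatJezequel2020] AS PRINTED (= THEOREM 6.4), literally for
`compHornerRd rd x a n` under `|rd t - t| ≤ 2u|t|` (`(2n + 1)(2u) < 1`): "With directed
rounding, the forward error in the compensated Horner algorithm is such that
`|CompHorner(p, x) - p(x)| ≤ 2u|p(x)| + 2γ₂ₙ₊₁(2u)² p̃(|x|)`".
[cite: GraillatJezequel2020, §6.2 Proposition 6.2] [cite: GraillatJezequelPicot2018, §6.3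
Theorem 6.4] -/
theorem abs_compHornerRd_sub_sum_le_two_gamma_sq {rd : K → K} {u : K} (hu : 0 ≤ u)
    (hacc : ∀ t, |rd t - t| ≤ 2 * u * |t|) {n : ℕ} (hn : ((2 * n + 1 : ℕ) : K) * (2 * u) < 1)
    (x : K) (a : ℕ → K) :
    |compHornerRd rd x a n - ∑ i ∈ range (n + 1), a i * x ^ i|
      ≤ 2 * u * |∑ i ∈ range (n + 1), a i * x ^ i|
        + 2 * gamma (2 * u) (2 * n + 1) ^ 2 * ∑ i ∈ range (n + 1), |a i| * |x| ^ i := by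
  have hv : (0 : K) ≤ 2 * u := by positivity
  have h := abs_compHornerRd_sub_sum_le hv hacc hn x a
  have hS0 : 0 ≤ ∑ i ∈ range (n + 1), |a i| * |x| ^ i :=
    Finset.sum_nonneg fun _ _ => by positivity
  nlinarith [mul_nonneg (sq_nonneg (gamma (2 * u) (2 * n + 1))) hS0]

/-- PROPOSITION 6.2 of [GraillatJezequel2020], relative form as printed, literally for
`compHornerRd rd x a n` under `|rd t - t| ≤ 2u|t|`:
`|CompHorner(p, x) - p(x)| / |p(x)| ≤ 2u + 2γ₂ₙ₊₁(2u)² cond(p, x)` (both sides `0` when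
`p(x) = 0`). [cite: GraillatJezequel2020, §6.2 Proposition 6.2] -/
theorem abs_compHornerRd_sub_sum_div_le {rd : K → K} {u : K} (hu : 0 ≤ u)
    (hacc : ∀ t, |rd t - t| ≤ 2 * u * |t|) {n : ℕ} (hn : ((2 * n + 1 : ℕ) : K) * (2 * u) < 1)
    (x : K) (a : ℕ → K) :
    |compHornerRd rd x a n - ∑ i ∈ range (n + 1), a i * x ^ i| / |∑ i ∈ range (n + 1), a i * x ^ i|
      ≤ 2 * u + 2 * gamma (2 * u) (2 * n + 1) ^ 2 * condPoly a x n := by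
  have h := abs_compHornerRd_sub_sum_le_two_gamma_sq hu hacc hn x a
  unfold condPoly
  set P := ∑ i ∈ range (n + 1), a i * x ^ i
  set S := ∑ i ∈ range (n + 1), |a i| * |x| ^ i
  rcases eq_or_lt_of_le (abs_nonneg P) with hP | hP
  · rw [← hP]
    simp only [div_zero, mul_zero, add_zero]
    positivity
  · rw [div_le_iff₀ hP]
    have e : (2 * u + 2 * gamma (2 * u) (2 * n + 1) ^ 2 * (S / |P|)) * |P|
        = 2 * u * |P| + 2 * gamma (2 * u) (2 * n + 1) ^ 2 * S := by
      field_simp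
    rw [e]
    exact h

end Literature.ComputerArithmetic.GraillatJezequelPicot2018
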